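import Summits.BirchSwinnertonDyer.BirchSwinnertonDyer.Theorems.ClassRecordThreeEulerHalvesAtThreeCartanCoverSplitSide
import Summits.BirchSwinnertonDyer.BirchSwinnertonDyer.Theorems.ClassRecordThreeEulerHalvesAtThreeCartanCoverEisensteinFamily
import Summits.BirchSwinnertonDyer.BirchSwinnertonDyer.Theorems.ClassRecordThreeEulerHalvesAtThreeCartanCoverHeckePeriods
import Literature.NumberTheory.Automorphic.ShimuraCurveCartanLevelHeckeDegree
import Literature.NumberTheory.EllipticCurves.ModPReducibilityAlmostAllProofs
import Literature.NumberTheory.EllipticCurves.LFunctionPrimeCoeff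
import Literature.NumberTheory.EllipticCurves.ComplexMultiplicationLFunctionIsogenyHoldsProofs
import HarnessLib

/-!
# Crux NUM `CartanOnePlaceDegreeLawAtThree` (item 24801), line `lattice` — brick 3′: the SPLIT-SIDE descent (D3_S) `CartanCover.DescentSplitAtThree` is a THEOREM
# modulo the same two PRINT facts as (D3)

Seat `bsd-stepL-tam3-p1` g27 (LEAD of crux 24801; `--supports stmt-BirchSwinnertonDyer-24801 --as helper`). THE ARGUMENT is that of brick 3 (`Descent.descentNonsplit_of_facts`,
p733044) run on the SPLIT torus quotient: for a transport datum (`g`, `F_s = Q'.form ∣[2] g⁻¹` on `Γ_{T_s} = g X'.Gamma g⁻¹`, isogeny scalar `α` of `3`-free degree `d`)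
suppose `α·u_S = 3w`, `w ∈ 𝕃(u_C, Λ(W₁))`. (1) Component at `1`: `α·∫^{g₀}F_s ∈ 3Λ(W₁)` for `g₀ ∈ Γ̄(q)`; with `∫^{g₀}F_s ∈ Λ(W₂)`, `dΛ(W₁) ⊆ αΛ(W₂)`, `3 ∤ d`,
`α ≠ 0`: `∫^{g₀}F_s ∈ 3Λ(W₂)` (`mem_three_of_smul_mem`). (2) For a good `ℓ` transport the coset data of `X'` (brick 1 `HeckePeriod.exists_perm_mul`, `period_smul_eq_sum`:
`a_ℓ(W₂)·∫^{γ'}Q'.form = Σ∫^{δ'_i}Q'.form`) along `g` into `ι(O_s)`, `O_s = {y ∈ O₀' : red y diagonal}` (the conjugacy clauses of the datum), and apply brick 2′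
(`Eisenstein.card_smul_period_sub_sum_mem_family` with `E = E₀₀`): `(ℓ+1)·∫^{γ'}Q'.form − Σ∫^{δ'_i}Q'.form ∈ 3Λ(W₂)` (`#(Γ'∖ι(O'(ℓ))) = ℓ + 1`: PRINT
`cartanLevel_card_heckeCosets_eq` for `X'`; periods of `F_s` at `gγ'g⁻¹` = periods of `Q'.form` at `γ'`). (3) `a_ℓ(W₂) = a_ℓ(V)` (Knapp 11.67, tree), `E[3]` irreducible ⟹
`a_ℓ(V) ≢ ℓ + 1 (3)` for some good `ℓ` (DDT 2.6, tree), Bezout ⟹ all `X'.Gamma`-periods of `Q'.form` in `3Λ(W₂)` ⟹ (4) PRINT `cartanParametrizationData_deg_of_periods_mul` on `X'`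
contradicts class-minimality of `Q'`. Hence `descentSplit_of_facts : cartanLevel_card_heckeCosets_eq → cartanParametrizationData_deg_of_periods_mul → DescentSplitAtThree`, and
with the glue `splitSideSheet_of_transport_of_descent` (p733729) the MIXED stub (P+T) reduces to the transport datum (T+P) alone: **`splitSideSheet_of_facts_of_transport`**.
HONEST: conditional on the two named print facts and on the transport datum `SplitSideTransportAtThree` (conjugacy = idea-10 X3, constructible; K-type ∕ Petersson = print);
nothing about NUM, (D4) or any curve is proved; BSD is proved for no curve. [cite: Mazur1977, §II.11] [cite: DarmonDiamondTaylor1995, Prop. 2.6 (b)] [cite: ShimuraIATAF1971, §8.3 (8.3.2)]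
-/

set_option linter.dupNamespace false
set_option autoImplicit false

noncomputable section

open scoped Classical Pointwise MatrixGroups ModularForm
open UpperHalfPlane ConjAct

namespace Summit.BirchSwinnertonDyer.BirchSwinnertonDyer.Theorems.CartanCover.Descent

open Literature.NumberTheory.Automorphic Literature.NumberTheory.EllipticCurves
open Summit.BirchSwinnertonDyer.Rank1Residual

variable {D M : ℕ} {C : Finset ℕ} {X : CartanLevelCurveData D M C} {q : ℕ}

/-! ## §1 Small lemmas -/

/-- A matrix with zero off-diagonal entries lies in `𝔽_q[E₀₀]`: `m = m₁₁·1 + (m₀₀ − m₁₁)·E₀₀`. [folklore] -/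
theorem mem_adjoin_splitGen_of_offdiag {m : Matrix (Fin 2) (Fin 2) (ZMod q)} (h01 : m 0 1 = 0) (h10 : m 1 0 = 0) :
    m ∈ Algebra.adjoin (ZMod q) ({splitGen q} : Set (Matrix (Fin 2) (Fin 2) (ZMod q))) := by
  have hm : m = (m 1 1) • (1 : Matrix (Fin 2) (Fin 2) (ZMod q)) + (m 0 0 - m 1 1) • splitGen q := by
    ext i j
    fin_cases i <;> fin_cases j <;> simp [splitGen, h01, h10]
  rw [hm]
  exact Subalgebra.add_mem _ (Subalgebra.smul_mem _ (Subalgebra.one_mem _) _)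
    (Subalgebra.smul_mem _ (Algebra.self_mem_adjoin_singleton (ZMod q) (splitGen q)) _)

/-- Lattice descent along a `3`-free isogeny scalar: if `α ≠ 0`, `α x = 3 t`, `x ∈ Λ₂`, `t ∈ Λ₁`, `dΛ₁ ⊆ αΛ₂` and `3 ∤ d`, then `x ∈ 3Λ₂`. [folklore] -/
theorem mem_three_of_smul_mem {Λ₁ Λ₂ : Submodule ℤ ℂ} {α : ℂ} (hα0 : α ≠ 0) {d : ℕ} (hd3 : ¬ 3 ∣ d)
    (hd : ∀ y ∈ Λ₁, ∃ x ∈ Λ₂, (d : ℂ) * y = α * x) {x t : ℂ} (hx : x ∈ Λ₂) (ht : t ∈ Λ₁) (hxt : α * x = 3 * t) :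
    ∃ x' ∈ Λ₂, x = 3 * x' := by
  obtain ⟨x'', hx'', hdt⟩ := hd t ht
  have hdx : ((d : ℤ) : ℂ) * x = 3 * x'' := by
    apply mul_left_cancel₀ hα0
    have e1 : α * (((d : ℤ) : ℂ) * x) = (d : ℂ) * (α * x) := by push_cast; ring
    rw [e1, hxt]
    calc (d : ℂ) * (3 * t) = 3 * ((d : ℂ) * t) := by ring
      _ = 3 * (α * x'') := by rw [hdt]
      _ = α * (3 * x'') := by ring
  have hd3' : ¬ (3 : ℤ) ∣ (d : ℤ) := by exact_mod_cast hd3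
  exact exists_eq_three_mul_of_coprime Λ₂ hx hx'' hd3' hdx

/-! ## §2 (D3_S) from the two print facts -/

/-- **(D3_S) `DescentSplitAtThree` FROM PRINT FACTS** (Hecke degree `ℓ + 1` on Cartan-level curves; degree of a parametrisation with `n`-divisible periods), through the
transported Hecke–period identity, the Eisenstein congruence on the SPLIT torus quotient, `a_ℓ(W₂) = a_ℓ(V)` (Knapp 11.67, tree) and `E[3]` irreducible ⟹ `a_ℓ(V) ≢ ℓ + 1 (3)`
for a good `ℓ` (DDT Prop. 2.6, tree). [cite: Mazur1977, §II.11] [cite: DarmonDiamondTaylor1995, Prop. 2.6 (b)] -/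
theorem descentSplit_of_facts (hHD : cartanLevel_card_heckeCosets_eq) (hISO : cartanParametrizationData_deg_of_periods_mul) :
    DescentSplitAtThree := by
  intro V _ _ hX _hS N D M C q _ X W₁ _ Q X' W₂ _ Q' hq R hN hDMC _hq3 _hq3N _hc _hQ hQ' g hg HO HΓ F_s hF_s α d hd3 hα hd
  rintro ⟨w, hw⟩
  classical
  haveI hT1 : (R.levelOf (CartanTorusCubeCut.torusSubgroup (splitGen q))).HasDetOne :=
    ⟨fun hg' => (R.levelOf_le (CartanTorusCubeCut.torusSubgroup (splitGen q)) hg').2.2⟩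
  have hIrr : V.HasIrreducibleModPGaloisRep 3 := hX.2.2.2
  -- `α ≠ 0`
  have hα0 : α ≠ 0 := by
    intro h0
    have hω : Q.L.ω₁ ∈ Q.L.lattice := Submodule.subset_span (by simp)
    obtain ⟨x, -, hx⟩ := hd Q.L.ω₁ hω
    rw [h0, zero_mul, mul_eq_zero] at hx
    rcases hx with hd0 | hω0
    · have : d = 0 := by exact_mod_cast hd0
      exact hd3 ⟨0, by rw [this]⟩
    · exact (LinearIndependent.ne_zero 0 Q.L.indep) (by simpa using hω0)
  -- the inverse conjugator has positive determinant
  have hg' : 0 < (g⁻¹).det.val := by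
    rw [map_inv, Units.val_inv_eq_inv_val]; exact inv_pos.mpr hg
  -- `Γ_{T_s} = g X'.Gamma g⁻¹` as subgroups, and the periods of `F_s` lie in `Λ(W₂)`
  have hΓeq : toConjAct (g⁻¹)⁻¹ • X'.Gamma = R.levelOf (CartanTorusCubeCut.torusSubgroup (splitGen q)) := by
    ext γ
    rw [mem_conjAct_inv_smul_iff, HΓ]
    constructor
    · intro h
      have : g * (g⁻¹ * γ * g⁻¹⁻¹) * g⁻¹ = γ := by group
      rwa [this] at h
    · intro h
      have : g * (g⁻¹ * γ * g⁻¹⁻¹) * g⁻¹ = γ := by group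
      rwa [this]
  have hperFs : HasPeriodsIn (R.levelOf (CartanTorusCubeCut.torusSubgroup (splitGen q))) (⇑F_s) (Q'.L.lattice : Set ℂ) := by
    rw [hF_s]
    exact CartanDegree.hasPeriodsIn_slash_of_conjAct_eq hΓeq Q'.form hg' Q'.period_mem
  -- periods of `F_s` at `g γ' g⁻¹` (base `g z₀`) are periods of `Q'.form` at `γ'` (base `z₀`)
  have hPtrans : ∀ (γ' : GL (Fin 2) ℝ) (z₀ : ℍ), segmentIntegral F_s (g • z₀) ((g * γ' * g⁻¹) • g • z₀) = segmentIntegral Q'.form z₀ (γ' • z₀) := by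
    intro γ' z₀
    rw [hF_s]
    have h := CartanDegree.segmentIntegral_slash_inv_smul Q'.form hg' (z₀) ((g * γ' * g⁻¹) • g • z₀)
    rw [inv_inv] at h
    rw [h]
    have e : g⁻¹ * (g * γ' * g⁻¹) * g = γ' := by group
    rw [← mul_smul, ← mul_smul, e]
  -- the exceptional set and the good prime
  have hN0 : N ≠ 0 := by rw [← hN]; exact (V.conductorNorm_pos_holds).ne'
  set S : Set ℕ := {ℓ | ℓ ∣ N} with hSdef
  have hSfin : S.Finite := (Set.finite_le_nat N).subset fun ℓ hℓ => Nat.le_of_dvd (Nat.pos_of_ne_zero hN0) hℓ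
  refine not_irreducible_of_frobeniusTrace_congr_off_finite V 3 S hSfin ?_ hIrr
  intro ℓ _ hℓS hℓ3 hgood
  by_contra h3
  have hℓ : ℓ.Prime := Fact.out
  have hℓN : ¬ ℓ ∣ N := hℓS
  -- `ℓ` is prime to the level `D · (M q²) · ∏_{C∖q} p` of `X'`
  have hlev : D * (M * q ^ 2) * ∏ p ∈ C.erase q, p ∣ N := by
    rw [← hDMC, ← Finset.mul_prod_erase C (fun p => p ^ 2) hq]
    have h1 : ∏ p ∈ C.erase q, p ∣ ∏ p ∈ C.erase q, p ^ 2 := Finset.prod_dvd_prod_of_dvd _ _ fun p _ => dvd_pow_self p two_ne_zero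
    calc D * (M * q ^ 2) * ∏ p ∈ C.erase q, p = D * M * (q ^ 2 * ∏ p ∈ C.erase q, p) := by ring
      _ ∣ D * M * (q ^ 2 * ∏ p ∈ C.erase q, p ^ 2) := mul_dvd_mul_left _ (mul_dvd_mul_left _ h1)
  have hℓDMC : ¬ ℓ ∣ D * (M * q ^ 2) * ∏ p ∈ C.erase q, p := fun h => hℓN (h.trans hlev)
  have hqℓ : ¬ q ∣ ℓ := by
    intro h
    have hqp : q.Prime := Fact.out
    have hql : q = ℓ := (Nat.prime_dvd_prime_iff_eq hqp hℓ).mp h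
    apply hℓDMC
    rw [← hql]
    exact ⟨D * M * q * ∏ p ∈ C.erase q, p, by ring⟩
  -- Hecke data of `X'` at `ℓ`
  obtain ⟨hfin, hcard⟩ := hHD D (M * q ^ 2) (C.erase q) X' ℓ hℓ hℓDMC
  letI : Fintype (Quotient (X'.heckeSetoid ℓ)) := Fintype.ofFinite _
  have hcard' : Fintype.card (Quotient (X'.heckeSetoid ℓ)) = ℓ + 1 := by rw [← Nat.card_eq_fintype_card, hcard]
  set a : ℤ := W₂.LFunction ℓ with hadef
  have hhecke : X'.heckeFun ℓ Q'.form = fun τ => ((a : ℤ) : ℂ) * Q'.form τ := Q'.hecke_eq ℓ hℓ hℓDMC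
  have haV : a = V.frobeniusTrace ℓ := by
    rw [hadef, ← LFunction_eq_of_isIsogenous_holds V W₂ hQ'.1, V.LFunction_apply_prime_eq_frobeniusTrace ℓ hgood]
  have h3' : ¬ (3 : ℤ) ∣ ((ℓ : ℤ) + 1 - a) := by
    intro h
    apply h3
    rw [← haV]
    have : a - ((ℓ : ℤ) + 1) = -(((ℓ : ℤ) + 1 - a)) := by ring
    rw [show ((3 : ℕ) : ℤ) = 3 by norm_num, this]
    exact (dvd_neg).mpr h
  -- the subgroup `3Λ(W₂)` and (1): `Γ̄(q)`-periods of `F_s` lie in it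
  set N₃ : AddSubgroup ℂ := Q'.L.lattice.toAddSubgroup.map (AddMonoidHom.mulLeft (3 : ℂ)) with hN₃
  have hmemN₃ : ∀ {x : ℂ}, x ∈ N₃ ↔ ∃ y ∈ Q'.L.lattice, x = 3 * y := by
    intro x
    rw [hN₃, AddSubgroup.mem_map]
    constructor
    · rintro ⟨y, hy, rfl⟩; exact ⟨y, hy, rfl⟩
    · rintro ⟨y, hy, rfl⟩; exact ⟨y, hy, rfl⟩
  have hcomp1 : (⇑(α • R.restrictLevel (CartanTorusCubeCut.torusSubgroup (splitGen q)) F_s) : ℍ → ℂ) = ⇑((((3 : ℤ) : ℂ)) • ((w : R.IndCuspForm).1 1)) := by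
    have h1 : (α • R.dockTorus (CartanTorusCubeCut.torusSubgroup (splitGen q)) F_s).1 1 = ((3 : ℤ) • (w : R.IndCuspForm)).1 1 := by
      rw [hw]
    rw [R.smul_apply_component, R.dockTorus_apply_one, ← Int.cast_smul_eq_zsmul ℂ (3 : ℤ) (w : R.IndCuspForm), R.smul_apply_component] at h1
    rw [h1]
  have hwper : HasPeriodsIn (principalLevel X q) (⇑((w : R.IndCuspForm).1 1)) (Q.L.lattice : Set ℂ) :=
    ((R.mem_periodLattice_iff Q.L.lattice _ _).mp w.2).2 1
  have hN₃per : ∀ g₀ ∈ principalLevel X q, ∀ z : ℍ, segmentIntegral F_s z (g₀ • z) ∈ N₃ := by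
    intro g₀ hg₀ z
    have hx : segmentIntegral F_s z (g₀ • z) ∈ Q'.L.lattice := hperFs g₀ (R.principalLevel_le_levelOf _ hg₀) z
    have ht : segmentIntegral ((w : R.IndCuspForm).1 1) z (g₀ • z) ∈ Q.L.lattice := hwper g₀ hg₀ z
    have hxt : α * segmentIntegral F_s z (g₀ • z) = 3 * segmentIntegral ((w : R.IndCuspForm).1 1) z (g₀ • z) := by
      have e1 := segmentIntegral_smul_principalLevel (R.restrictLevel (CartanTorusCubeCut.torusSubgroup (splitGen q)) F_s) α z (g₀ • z)
      have e2 := segmentIntegral_smul_principalLevel ((w : R.IndCuspForm).1 1) ((3 : ℤ) : ℂ) z (g₀ • z)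
      rw [hcomp1] at e1
      rw [R.coe_restrictLevel] at e1
      rw [← e1, e2]; push_cast; ring
    obtain ⟨x', hx', hxeq⟩ := mem_three_of_smul_mem hα0 hd3 hd hx ht hxt
    exact hmemN₃.mpr ⟨x', hx', hxeq⟩
  -- (2)+(3): every `X'.Gamma`-period of `Q'.form` lies in `3Λ(W₂)`
  have hper3 : ∀ γ' ∈ X'.Gamma, ∀ z₀ : ℍ, ∃ x ∈ Q'.L.lattice, segmentIntegral Q'.form z₀ (γ' • z₀) = ((3 : ℕ) : ℂ) * x := by
    intro γ' hγ' z₀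
    obtain ⟨e, δ', hδ', hδ'eq⟩ := HeckePeriod.exists_perm_mul X' ℓ hγ'
    have h1 := HeckePeriod.period_smul_eq_sum X' ℓ Q'.form ((a : ℤ) : ℂ) hhecke e δ' hδ' hδ'eq z₀
    -- transport the coset data into `ι(O_s)`
    have hα' : ∀ i : Quotient (X'.heckeSetoid ℓ), ∃ y : coverSubring X q, (R.red y) 0 1 = 0 ∧ (R.red y) 1 0 = 0 ∧
        X.ι (y : X.B) = (g : Matrix (Fin 2) (Fin 2) ℝ) * (((i.out : X'.heckeSet ℓ) : GL (Fin 2) ℝ) : Matrix (Fin 2) (Fin 2) ℝ) *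
          ((g⁻¹ : GL (Fin 2) ℝ) : Matrix (Fin 2) (Fin 2) ℝ) :=
      fun i => (HO _).mp (i.out : X'.heckeSet ℓ).2.1
    choose y hy01 hy10 hyι using hα'
    have hydet : ∀ i, (X.ι (y i : X.B)).det = ℓ := by
      intro i
      rw [hyι, Matrix.det_units_conj]
      exact (i.out : X'.heckeSet ℓ).2.2
    obtain ⟨yγ, hyγ01, hyγ10, hyγι⟩ := (HO _).mp hγ'.1
    have hd' : ∀ i, ∃ dd : coverSubring X q, (R.red dd) 0 1 = 0 ∧ (R.red dd) 1 0 = 0 ∧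
        X.ι (dd : X.B) = (g : Matrix (Fin 2) (Fin 2) ℝ) * ((δ' i : GL (Fin 2) ℝ) : Matrix (Fin 2) (Fin 2) ℝ) * ((g⁻¹ : GL (Fin 2) ℝ) : Matrix (Fin 2) (Fin 2) ℝ) :=
      fun i => (HO _).mp (hδ' i).1
    choose dd hdd01 hdd10 hddι using hd'
    -- the conjugated group elements
    have hγs : g * γ' * g⁻¹ ∈ R.levelOf (CartanTorusCubeCut.torusSubgroup (splitGen q)) := (HΓ γ').mp hγ'
    have hδs : ∀ i, g * δ' i * g⁻¹ ∈ R.levelOf (CartanTorusCubeCut.torusSubgroup (splitGen q)) := fun i => (HΓ (δ' i)).mp (hδ' i)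
    have hyγι' : X.ι (yγ : X.B) = ((g * γ' * g⁻¹ : GL (Fin 2) ℝ) : Matrix (Fin 2) (Fin 2) ℝ) := by rw [hyγι, Units.val_mul, Units.val_mul]
    have hddι' : ∀ i, X.ι (dd i : X.B) = ((g * δ' i * g⁻¹ : GL (Fin 2) ℝ) : Matrix (Fin 2) (Fin 2) ℝ) := fun i => by
      rw [hddι, Units.val_mul, Units.val_mul]
    -- the relations `y_i yγ = d_i y_{e i}`
    have hrel : ∀ i, y i * yγ = dd i * y (e i) := by
      intro i
      apply Subtype.ext
      apply X.ι_injective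
      rw [Subring.coe_mul, Subring.coe_mul, map_mul, map_mul, hyι, hyγι, hddι, hyι]
      have h := congrArg (fun u : GL (Fin 2) ℝ => (g : Matrix (Fin 2) (Fin 2) ℝ) * (u : Matrix (Fin 2) (Fin 2) ℝ) * ((g⁻¹ : GL (Fin 2) ℝ) : Matrix (Fin 2) (Fin 2) ℝ)) (hδ'eq i)
      simp only [Units.val_mul] at h
      have hgg : ((g⁻¹ : GL (Fin 2) ℝ) : Matrix (Fin 2) (Fin 2) ℝ) * (g : Matrix (Fin 2) (Fin 2) ℝ) = 1 := by
        rw [← Units.val_mul, inv_mul_cancel, Units.val_one]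
      calc (g : Matrix (Fin 2) (Fin 2) ℝ) * ((i.out : X'.heckeSet ℓ) : GL (Fin 2) ℝ) * ((g⁻¹ : GL (Fin 2) ℝ) : Matrix (Fin 2) (Fin 2) ℝ) *
            ((g : Matrix (Fin 2) (Fin 2) ℝ) * (γ' : Matrix (Fin 2) (Fin 2) ℝ) * ((g⁻¹ : GL (Fin 2) ℝ) : Matrix (Fin 2) (Fin 2) ℝ))
          = (g : Matrix (Fin 2) (Fin 2) ℝ) * (((i.out : X'.heckeSet ℓ) : GL (Fin 2) ℝ) * (((g⁻¹ : GL (Fin 2) ℝ) : Matrix (Fin 2) (Fin 2) ℝ) *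
              (g : Matrix (Fin 2) (Fin 2) ℝ)) * (γ' : Matrix (Fin 2) (Fin 2) ℝ)) * ((g⁻¹ : GL (Fin 2) ℝ) : Matrix (Fin 2) (Fin 2) ℝ) := by
            simp only [Matrix.mul_assoc]
        _ = (g : Matrix (Fin 2) (Fin 2) ℝ) * ((δ' i : GL (Fin 2) ℝ) * (((e i).out : X'.heckeSet ℓ) : GL (Fin 2) ℝ)) *
              ((g⁻¹ : GL (Fin 2) ℝ) : Matrix (Fin 2) (Fin 2) ℝ) := by rw [hgg, Matrix.mul_one, h]
        _ = (g : Matrix (Fin 2) (Fin 2) ℝ) * (δ' i : GL (Fin 2) ℝ) * ((g⁻¹ : GL (Fin 2) ℝ) : Matrix (Fin 2) (Fin 2) ℝ) *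
              ((g : Matrix (Fin 2) (Fin 2) ℝ) * (((e i).out : X'.heckeSet ℓ) : GL (Fin 2) ℝ) * ((g⁻¹ : GL (Fin 2) ℝ) : Matrix (Fin 2) (Fin 2) ℝ)) := by
            rw [show (g : Matrix (Fin 2) (Fin 2) ℝ) * (δ' i : GL (Fin 2) ℝ) * ((g⁻¹ : GL (Fin 2) ℝ) : Matrix (Fin 2) (Fin 2) ℝ) *
                ((g : Matrix (Fin 2) (Fin 2) ℝ) * (((e i).out : X'.heckeSet ℓ) : GL (Fin 2) ℝ) * ((g⁻¹ : GL (Fin 2) ℝ) : Matrix (Fin 2) (Fin 2) ℝ))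
                = (g : Matrix (Fin 2) (Fin 2) ℝ) * ((δ' i : GL (Fin 2) ℝ) * (((g⁻¹ : GL (Fin 2) ℝ) : Matrix (Fin 2) (Fin 2) ℝ) * (g : Matrix (Fin 2) (Fin 2) ℝ)) *
                  (((e i).out : X'.heckeSet ℓ) : GL (Fin 2) ℝ)) * ((g⁻¹ : GL (Fin 2) ℝ) : Matrix (Fin 2) (Fin 2) ℝ) by simp only [Matrix.mul_assoc],
              hgg, Matrix.mul_one]
    -- the Eisenstein congruence on the split side (base point `g • z₀`)
    have h2 := Eisenstein.card_smul_period_sub_sum_mem_family R (splitGen q) (Γ' := R.levelOf (CartanTorusCubeCut.torusSubgroup (splitGen q))) (R.levelOf_le _) F_s N₃ hN₃per hqℓ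
      yγ (mem_adjoin_splitGen_of_offdiag hyγ01 hyγ10) hγs hyγι'
      y (fun i => mem_adjoin_splitGen_of_offdiag (hy01 i) (hy10 i)) hydet
      dd (fun i => mem_adjoin_splitGen_of_offdiag (hdd01 i) (hdd10 i)) (fun i => g * δ' i * g⁻¹) hδs hddι' e hrel (g • z₀)
    rw [hcard'] at h2
    simp only [hPtrans] at h2
    have h12 : (((ℓ : ℤ) + 1 - a : ℤ) : ℂ) * segmentIntegral Q'.form z₀ (γ' • z₀) ∈ N₃ := by
      have e' : (((ℓ : ℤ) + 1 - a : ℤ) : ℂ) * segmentIntegral Q'.form z₀ (γ' • z₀) =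
          (((ℓ + 1 : ℕ) : ℂ) * segmentIntegral Q'.form z₀ (γ' • z₀) - ∑ i, segmentIntegral Q'.form z₀ (δ' i • z₀))
            - (((a : ℤ) : ℂ) * segmentIntegral Q'.form z₀ (γ' • z₀) - ∑ i, segmentIntegral Q'.form z₀ (δ' i • z₀)) := by
        push_cast; ring
      rw [e']
      refine N₃.sub_mem h2 ?_
      rw [h1, sub_self]
      exact N₃.zero_mem
    obtain ⟨yv, hyv, hyveq⟩ := hmemN₃.mp h12
    obtain ⟨x', hx', hxeq⟩ := exists_eq_three_mul_of_coprime Q'.L.lattice (Q'.period_mem γ' hγ' z₀) hyv h3' hyveq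
    exact ⟨x', hx', by rw [hxeq]; push_cast; ring⟩
  -- (4) contradiction with class-minimality of `Q'`
  obtain ⟨Q'', hQ''⟩ := hISO D (M * q ^ 2) (C.erase q) X' W₂ Q' 3 (by norm_num) hper3
  have hle : Q'.deg ≤ Q''.deg := hQ'.2 W₂ Q'' hQ'.1
  have hpos : 0 < Q''.deg := Q''.deg_pos
  omega

/-- **(P+T) FROM THE TRANSPORT DATUM ALONE, modulo the two print facts**: `SplitSideTransportAtThree → SplitSideSheetAtThree` (glue p733729 + `descentSplit_of_facts`). -/
theorem splitSideSheet_of_facts_of_transport (hHD : cartanLevel_card_heckeCosets_eq) (hISO : cartanParametrizationData_deg_of_periods_mul)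
    (hT : SplitSideTransportAtThree) : SplitSideSheetAtThree :=
  splitSideSheet_of_transport_of_descent hT (descentSplit_of_facts hHD hISO)

end Summit.BirchSwinnertonDyer.BirchSwinnertonDyer.Theorems.CartanCover.Descent

end
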